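import Summits.Ventures.PercRepro.ProfilePointedCircuitClassesStarSharpPencilB

/-!
# PercRepro — THE PENCIL THROUGH `ℓ ∈ X`, PART C: THE LINE `eℓ` SEEN FROM `ℓ`, THE C-TARGETS, THE N-CLASS
(p5, gen 56; `proofs/P5-GM1.md` §83)

The pencil through `ℓ ∈ X` (`b` generic, `ρ{e, ℓ, b, b′} = 3`, `f` off the ON line: `ρ{e, f, ℓ} = 3`).  The bad
demands split into three classes — N (`c1`, `ℓ ∈ π`), X (`c1`, `ℓ ∉ π`), F (`¬c1`) — and the targets of the fourth
and fifth kinds (the C-targets `{e, f, x} + b`) by whether `x` is off the plane `P_f := cl{e, f, ℓ}`, the free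
bi-bases of the third kind by whether the pair lies inside `X ∖ P_f`.  This part: a set containing `ℓ` is ON iff `e`
lies in its closure (`on_iff_of_line_le`), the C-targets (`cpoint_target_mem`), the free bi-bases
(`free_bibasis_mem`), and the N-class injects into its C-targets by `{ℓ, t} + e + b ↦ {e, f, t} + b`
(`pencilX_card_N_le`: `t` is a C-point by `pencilX_cpoint_of_swap`, and `{e, f, ℓ, t}` has rank 4 by `c1`).
-/

open scoped Matroid

namespace PercRepro.Cogirth

open Finset ThmH Skew Shadow Profile

open Classical

variable {α : Type} [DecidableEq α] {N : Matroid α} [N.Finite]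

section StarSharpPencilC

variable {b b' : α}

/-- **THE LINE `eℓ` SEEN FROM `ℓ`**: a set `S ∋ ℓ` is ON iff `e ∈ cl(S)` (`on_iff_of_line_ef` with the roles of
`e` and `ℓ` exchanged). -/
theorem on_iff_of_line_le (h : SeriesPair N b b') {e f : α} (he : e ∈ gr N) (heb : e ≠ b) (heb' : e ≠ b')
    (he1 : ∀ y ∈ ((((gr N).erase b).erase b').erase f).erase e, rk N {e, y} = 2)
    (hbg : ∀ y ∈ ((((gr N).erase b).erase b').erase f).erase e, rk N {y, b, b'} = 3)
    {l : α} (hlX : l ∈ ((((gr N).erase b).erase b').erase f).erase e) (hlon : rk N (insert b (insert b' {e, l})) = 3)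
    {S : Finset α} (hS : S ⊆ ((gr N).erase b).erase b') (hlS : l ∈ S) :
    rk N (insert b (insert b' S)) = rk N S + 1 ↔ rk N (insert e S) = rk N S := by
  have hXg : ((((gr N).erase b).erase b').erase f).erase e ⊆ gr N :=
    (erase_subset _ _).trans ((erase_subset _ _).trans ((erase_subset _ _).trans (erase_subset _ _)))
  have hle : rk N {l, e} = 2 := by rw [pair_comm']; exact he1 l hlX
  have hlon' : rk N (insert b (insert b' {l, e})) = 3 := by rw [pair_comm']; exact hlon
  exact on_iff_of_line_ef h (hXg hlX) he heb heb' hlon' hle (hbg l hlX) hS hlS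

/-- A C-point `x` (`ρ{e, f, x} = 3`, `ρ(X − x) = 4`) gives the C-target `{e, f, x} + b` (a bi-independent set
containing `e, f, b` and avoiding `b′`). -/
theorem cpoint_target_mem (hn : (gr N).card = 9) (h : SeriesPair N b b') {e f : α} (he : e ∈ gr N) (hf : f ∈ gr N)
    (hef : e ≠ f) (heb : e ≠ b) (heb' : e ≠ b') (hfb : f ≠ b) (hfb' : f ≠ b')
    {x : α} (hx : x ∈ ((((gr N).erase b).erase b').erase f).erase e)
    (hefx : rk N {e, f, x} = 3) (hx4 : rk N ((((((gr N).erase b).erase b').erase f).erase e).erase x) = 4) :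
    insert b {e, f, x} ∈ (biIndepSets N 4).filter (fun W => (f ∈ W ∧ b' ∉ W) ∧ (e ∈ W ∧ b ∈ W)) := by
  have hXE : ((((gr N).erase b).erase b').erase f).erase e ⊆ ((gr N).erase b).erase b' :=
    (erase_subset _ _).trans (erase_subset _ _)
  have hfE : f ∈ ((gr N).erase b).erase b' := mem_erase.2 ⟨hfb', mem_erase.2 ⟨hfb, hf⟩⟩
  have heE : e ∈ ((gr N).erase b).erase b' := mem_erase.2 ⟨heb', mem_erase.2 ⟨heb, he⟩⟩
  have hbb' : b ≠ b' := h.2.2.1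
  have hS : ({e, f, x} : Finset α) ⊆ ((gr N).erase b).erase b' := by
    intro w hw; simp only [mem_insert, mem_singleton] at hw
    rcases hw with rfl | rfl | rfl
    · exact heE
    · exact hfE
    · exact hXE hx
  have hS3' : ({e, f, x} : Finset α).card = 3 := by
    have hxe : x ≠ e := (mem_erase.1 hx).1
    have hxf : x ≠ f := (mem_erase.1 (mem_erase.1 hx).2).1
    rw [card_insert_of_notMem, card_pair hxf.symm]
    simp only [mem_insert, mem_singleton, not_or]; exact ⟨hef, hxe.symm⟩
  simp only [mem_filter]
  refine ⟨?_, ⟨mem_insert_of_mem (mem_insert_of_mem (mem_insert_self _ _)), ?_⟩,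
    mem_insert_of_mem (mem_insert_self _ _), mem_insert_self _ _⟩
  · rw [insert_b_mem_biIndepSets_iff h hn hS hS3', E7_sdiff_efx_eq]
    exact ⟨hefx, hx4⟩
  · intro h'
    simp only [mem_insert, mem_singleton] at h'
    rcases h' with h2 | h2 | h2 | h2
    · exact hbb' h2.symm
    · exact heb' h2.symm
    · exact hfb' h2.symm
    · exact (mem_erase.1 (hXE hx)).1 h2.symm

/-- `b` is not in `{e, f, x}` for `x ∈ X`. -/
theorem b_notMem_efx {e f x : α} (heb : e ≠ b) (hfb : f ≠ b)
    (hx : x ∈ ((((gr N).erase b).erase b').erase f).erase e) : b ∉ ({e, f, x} : Finset α) := by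
  have hxb : x ≠ b := (mem_erase.1 ((erase_subset _ _) ((erase_subset _ _) ((erase_subset _ _) hx)))).1
  intro h'
  simp only [mem_insert, mem_singleton] at h'
  rcases h' with h2 | h2 | h2
  · exact heb h2.symm
  · exact hfb h2.symm
  · exact hxb h2.symm

/-- A pair `π ∋ ℓ` is `{ℓ, t}` for some `t ≠ ℓ` in `π`. -/
theorem pair_eq_insert_of_mem {π : Finset α} (hπ2 : π.card = 2) {l : α} (hl : l ∈ π) :
    ∃ t, t ≠ l ∧ t ∈ π ∧ π = {l, t} := by
  obtain ⟨x, y, hxy, rfl⟩ := card_eq_two.1 hπ2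
  rcases mem_insert.1 hl with rfl | hl'
  · exact ⟨y, hxy.symm, mem_insert_of_mem (mem_singleton_self _), rfl⟩
  · rw [mem_singleton] at hl'
    subst hl'
    exact ⟨x, hxy, mem_insert_self _ _, pair_comm' _ _⟩

/-- The image of the N-demand `{ℓ, t} + e + b` under `W ↦ W − ℓ + f` is the C-target `{e, f, t} + b`. -/
theorem image_N_eq {b e f l t : α} (hlb : l ≠ b) (hle : l ≠ e) (hlt : l ≠ t) :
    insert f ((insert b (insert e ({l, t} : Finset α))).erase l) = insert b {e, f, t} := by
  ext x
  simp only [mem_insert, mem_erase, mem_singleton]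
  constructor
  · rintro (rfl | ⟨hxl, rfl | rfl | rfl | rfl⟩)
    · exact Or.inr (Or.inr (Or.inl rfl))
    · exact Or.inl rfl
    · exact Or.inr (Or.inl rfl)
    · exact absurd rfl hxl
    · exact Or.inr (Or.inr (Or.inr rfl))
  · rintro (rfl | rfl | rfl | rfl)
    · exact Or.inr ⟨hlb.symm, Or.inl rfl⟩
    · exact Or.inr ⟨hle.symm, Or.inr (Or.inl rfl)⟩
    · exact Or.inl rfl
    · exact Or.inr ⟨hlt.symm, Or.inr (Or.inr (Or.inr rfl))⟩

/-- `{e, f, t} + ℓ = {ℓ, t} + e + f`. -/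
theorem insert_l_eft_eq (e f l t : α) : insert l ({e, f, t} : Finset α) = insert f (insert e {l, t}) := by
  ext x; simp only [mem_insert, mem_singleton]; tauto

/-- **THE N-CLASS**: the bad demands `{ℓ, t} + e + b` with `c1` inject into the C-targets `{e, f, t} + b` with
`ρ{e, f, ℓ, t} = 4` by `W ↦ W − ℓ + f` (`t` is a C-point: `pencilX_cpoint_of_swap`; the demand is not a defect:
`pencilX_not_mem_of_c1_defect`). -/
theorem pencilX_card_N_le (hn : (gr N).card = 9) (hR : rk N (gr N) = 5) (h : SeriesPair N b b')
    {e f : α} (he : e ∈ gr N) (hf : f ∈ gr N) (hef : e ≠ f) (heb : e ≠ b) (heb' : e ≠ b') (hfb : f ≠ b) (hfb' : f ≠ b')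
    (hf1 : ∀ y ∈ ((((gr N).erase b).erase b').erase f).erase e, rk N {f, y} = 2)
    (hfc : ∀ y ∈ ((((gr N).erase b).erase b').erase f).erase e, rk N (((((gr N).erase b).erase b').erase f).erase y) = 4)
    (heb3 : rk N {e, b, b'} = 3)
    (hbg : ∀ y ∈ ((((gr N).erase b).erase b').erase f).erase e, rk N {y, b, b'} = 3)
    {l : α} (hlX : l ∈ ((((gr N).erase b).erase b').erase f).erase e) (hlon : rk N (insert b (insert b' {e, l})) = 3) :
    ((d0DON N b' e f).filter (fun W => (¬ d0c0 N b b' e f W ∧ ¬ (d0c1 N b e f W ∧ d0c2 N b b' e f W)) ∧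
        (d0c1 N b e f W ∧ l ∈ W))).card ≤
      ((biIndepSets N 4).filter (fun W => ((f ∈ W ∧ b' ∉ W) ∧ (e ∈ W ∧ b ∈ W)) ∧
        rk N (insert l (W.erase b)) = 4)).card := by
  have hle : l ≠ e := (mem_erase.1 hlX).1
  have hlb : l ≠ b := (mem_erase.1 (mem_erase.1 (mem_erase.1 (mem_erase.1 hlX).2).2).2).1
  apply card_le_card_of_injOn (fun W => insert f (W.erase l))
  · intro W hW
    simp only [mem_coe, mem_filter] at hW
    obtain ⟨hWd, ⟨hc0, hc12⟩, hc1, hlW⟩ := hW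
    have hWd' := hWd
    simp only [d0DON, mem_filter] at hWd'
    obtain ⟨hbW, hπX, hπ2, hYeq, hWeq, hπe, hYf, hon⟩ :=
      d0_demand_data h hn hf hef heb hfb hfb' (e := e) W hWd'.1 hWd'.2.1 hWd'.2.2
    have hlπ : l ∈ (W.erase b).erase e := mem_erase.2 ⟨hle, mem_erase.2 ⟨hlb, hlW⟩⟩
    obtain ⟨t, htl, htπ, hπeq⟩ := pair_eq_insert_of_mem hπ2 hlπ
    have htX : t ∈ ((((gr N).erase b).erase b').erase f).erase e := hπX htπ
    have hc2 : ¬ d0c2 N b b' e f W := fun h2 => hc12 ⟨hc1, h2⟩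
    have hswap : rk N (insert f ((W.erase b).erase e)) = 3 ∧
        rk N (insert e (((((gr N).erase b).erase b').erase f).erase e \ (W.erase b).erase e)) = 4 := by
      by_contra hres
      exact pencilX_not_mem_of_c1_defect hn h he hf hef heb heb' hfb hfb' hfc heb3 hlX hlon hWd hc1 hc2 hres hlπ
    obtain ⟨heft, ht4⟩ := pencilX_cpoint_of_swap hn hR h he hf hef heb heb' hfb hfb' hf1 hbg hlX hlon hWd hc1 hc2
      hswap.2 htπ htl
    have hWform : W = insert b (insert e {l, t}) := by rw [← hπeq, hYeq, hWeq]
    have himg : insert f (W.erase l) = insert b {e, f, t} := by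
      rw [hWform]; exact image_N_eq hlb hle htl.symm
    show insert f (W.erase l) ∈ _
    rw [himg]
    have hmem := cpoint_target_mem hn h he hf hef heb heb' hfb hfb' htX heft ht4
    simp only [mem_coe, mem_filter] at hmem ⊢
    refine ⟨hmem.1, hmem.2, ?_⟩
    rw [erase_insert (b_notMem_efx heb hfb htX), insert_l_eft_eq]
    unfold d0c1 at hc1
    rw [hπeq] at hc1
    exact hc1
  · intro W₁ hW₁ W₂ hW₂ heq
    simp only [mem_coe, mem_filter, d0DON] at hW₁ hW₂
    have hfW₁ : f ∉ W₁.erase l := fun h' => hW₁.1.2.1.1.2 (mem_of_mem_erase h')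
    have hfW₂ : f ∉ W₂.erase l := fun h' => hW₂.1.2.1.1.2 (mem_of_mem_erase h')
    have hlW₁ : l ∈ W₁ := hW₁.2.2.2
    have hlW₂ : l ∈ W₂ := hW₂.2.2.2
    have heq' : insert f (W₁.erase l) = insert f (W₂.erase l) := heq
    have h1 : (insert f (W₁.erase l)).erase f = (insert f (W₂.erase l)).erase f := by rw [heq']
    rw [erase_insert hfW₁, erase_insert hfW₂] at h1
    rw [← insert_erase hlW₁, ← insert_erase hlW₂, h1]

/-- **A FREE BI-BASIS OF THE THIRD KIND**: for `x ≠ y ∈ X`, the set `{x, y} + e + f` of rank 4 whose complement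
`X − x − y` is OFF (`ρ((X − x − y) + b + b′) = 5`) and whose pair `{x, y} + e` is not ON is a bi-basis outside the
image of `d0_injR2''`. -/
theorem free_bibasis_mem (hn : (gr N).card = 9) (h : SeriesPair N b b') {e f : α} (he : e ∈ gr N) (hf : f ∈ gr N)
    (hef : e ≠ f) (heb : e ≠ b) (heb' : e ≠ b') (hfb : f ≠ b) (hfb' : f ≠ b')
    {x y : α} (hx : x ∈ ((((gr N).erase b).erase b').erase f).erase e)
    (hy : y ∈ ((((gr N).erase b).erase b').erase f).erase e) (hxy : x ≠ y)
    (h4 : rk N (insert f (insert e {x, y})) = 4)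
    (hoff : rk N (insert b (insert b' (((((gr N).erase b).erase b').erase f).erase e \ {x, y}))) = 5)
    (hnon : ¬ rk N (insert b (insert b' (insert e {x, y}))) = 4) :
    insert f (insert e {x, y}) ∈ (biIndepSets N 4).filter (fun B => ((f ∈ B ∧ b' ∉ B) ∧ (e ∈ B ∧ b ∉ B)) ∧
      ¬ (insert b (B.erase f) ∈ biIndepSets N 4 ∧ rk N (insert b (insert b' (B.erase f))) = 4)) := by
  have hXE : ((((gr N).erase b).erase b').erase f).erase e ⊆ ((gr N).erase b).erase b' :=
    (erase_subset _ _).trans (erase_subset _ _)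
  have hfE : f ∈ ((gr N).erase b).erase b' := mem_erase.2 ⟨hfb', mem_erase.2 ⟨hfb, hf⟩⟩
  have heE : e ∈ ((gr N).erase b).erase b' := mem_erase.2 ⟨heb', mem_erase.2 ⟨heb, he⟩⟩
  have hxe : x ≠ e := (mem_erase.1 hx).1
  have hxf : x ≠ f := (mem_erase.1 (mem_erase.1 hx).2).1
  have hxb : x ≠ b := (mem_erase.1 ((erase_subset _ _) ((erase_subset _ _) ((erase_subset _ _) hx)))).1
  have hxb' : x ≠ b' := (mem_erase.1 (hXE hx)).1
  have hye : y ≠ e := (mem_erase.1 hy).1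
  have hyf : y ≠ f := (mem_erase.1 (mem_erase.1 hy).2).1
  have hyb : y ≠ b := (mem_erase.1 ((erase_subset _ _) ((erase_subset _ _) ((erase_subset _ _) hy)))).1
  have hyb' : y ≠ b' := (mem_erase.1 (hXE hy)).1
  have hWE : insert f (insert e {x, y}) ⊆ ((gr N).erase b).erase b' :=
    insert_subset hfE (insert_subset heE (insert_subset (hXE hx) (singleton_subset_iff.2 (hXE hy))))
  have hfπ : f ∉ insert e ({x, y} : Finset α) := by
    simp only [mem_insert, mem_singleton, not_or]; exact ⟨hef.symm, hxf.symm, hyf.symm⟩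
  have hW4 : (insert f (insert e ({x, y} : Finset α))).card = 4 := by
    rw [card_insert_of_notMem hfπ, card_insert_of_notMem, card_pair hxy]
    simp only [mem_insert, mem_singleton, not_or]; exact ⟨hxe.symm, hye.symm⟩
  simp only [mem_filter]
  refine ⟨?_, ⟨⟨mem_insert_self _ _, ?_⟩, mem_insert_of_mem (mem_insert_self _ _), ?_⟩, ?_⟩
  · rw [mem_biIndepSets_iff_of_subset_E7 h hn hWE hW4, E7_sdiff_insert_ef_eq]
    exact ⟨h4, hoff⟩
  · simp only [mem_insert, mem_singleton, not_or]
    exact ⟨hfb'.symm, heb'.symm, hxb'.symm, hyb'.symm⟩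
  · simp only [mem_insert, mem_singleton, not_or]
    exact ⟨hfb.symm, heb.symm, hxb.symm, hyb.symm⟩
  · rw [erase_insert hfπ]
    exact fun h' => hnon h'.2

end StarSharpPencilC

end PercRepro.Cogirth
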